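import Mathlib
import Literature.Barriers.MatrixMultiplication.QuasirandomBarrierProofs
import Summits.MatrixMultiplication.MatrixMultiplication.Theorems.SnSubsetDichotomyGlobalBranchStubBlockDictionary
import Summits.MatrixMultiplication.MatrixMultiplication.Theorems.SnSubsetDichotomyPolynomialSlackSpechtDimCubic
import Summits.MatrixMultiplication.MatrixMultiplication.Theorems.SnSubsetDichotomyPolynomialSlackLevelTwoBlocks

/-!
# Level-two pinning: the BCGPU identity dissected down to level two

The LEVEL-TWO programme on the crux `SnSubsetDichotomy.PolynomialSlack`
(stmt-MatrixMultiplication-8306), main analytic step (the level-one version is `levelOnePinning`).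

For a TPP triple `S, T, U ⊆ S_n` with `N = |S||T||U|`, the tree's proof of BCGPU 2023 Thm. 3.2 reads
`n!·N = Σᵢ dᵢ tr(zᵢ)` over the Wedderburn blocks of `ℂ[S_n]`,
`z = 𝟙_{S⁻¹}𝟙_T·𝟙_{T⁻¹}𝟙_U·𝟙_{U⁻¹}𝟙_S`. Here the blocks are DISSECTED by their partition
(`stub_blockDictionary`): the EIGHT blocks of level `≤ 2` — `(n), (n-1,1), (n-2,2), (n-2,1,1)` and
their transposes — are evaluated EXACTLY (`…LowBlocks`, `…LevelTwoBlocks`; for parity-pure sets a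
block and its transpose contribute the same) through the six-fold statistics of the words
`w = s⁻¹t·t'⁻¹u·u'⁻¹s'`: `T₃ = Σ #fix(w)`,
`P₂ = Σ #{(p,q) : p ≠ q, w p = p, w q = q}`, `I_Σ = Σ #{s : #s = 2, w(s) ⊆ s}`; all remaining blocks
have dimension `≥ D₃ = n(n-1)(n-2)/24` (`cubic_le_numStandardTableaux`) and are bounded through
Parseval by `N·n!^{3/2}/√D₃`. The result (`levelTwoPinning`, `n ≥ 40`, parity-pure TPP triple):

  `|n!·N - (2N² + 2(n-1)(T₃ - N²) + 2[(C(n,2)-n)(I_Σ - T₃) + (C(n,2)-n+1)(P₂ - T₃ + N² - I_Σ)])|`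
  `≤ N·n!·√(n!)/√D₃`,

of precision `(n!)^{3/2}/n^{3/2}` in the volume `N` (level one: `(n!)^{3/2}/n`).
-/

namespace Summit.MatrixMultiplication.MatrixMultiplication.Theorems.PolynomialSlack

open scoped BigOperators Matrix
open Literature.Combinatorics.Additive (TripleProductProperty indicatorElem indicatorElemInv)
open Literature.NumberTheory.DiophantineGeometry (spechtCharacter numStandardTableaux)
open Literature.RepresentationTheory.FiniteGroups (BlockAlgebraC blockRep character_blockRep_apply)
open Summit.MatrixMultiplication.MatrixMultiplication.Theorems.GlobalBranch
  (blockDictionary_character_blockRep_one stub_blockDictionary)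

-- `Summit.<Summit>.<Problem>` is the tree's mandated summit-side namespace (CONVENTIONS §2); for
-- this single-conjunct summit the two coincide, so each declaration silences `dupNamespace`.
set_option linter.dupNamespace false

/-- Blocks indexed by a partition which is none of the eight shapes of level `≤ 2` have dimension
`≥ n(n-1)(n-2)/24` (`n ≥ 40`). [folklore] -/
theorem large_dim_of_not_low₂ {n : ℕ} (hn : 40 ≤ n) (μ : Nat.Partition n)
    (h : μ.sortedParts ∉ [[n], [n - 1, 1], [n - 2, 2], [n - 2, 1, 1], List.replicate n 1,
      2 :: List.replicate (n - 2) 1, 2 :: 2 :: List.replicate (n - 4) 1,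
      3 :: List.replicate (n - 3) 1]) :
    ((n * (n - 1) * (n - 2) : ℕ) : ℝ) / 24 ≤ numStandardTableaux μ := by
  obtain ⟨hrow, hcol⟩ := parts_le_of_not_level_two (by omega) μ h
  have key := cubic_le_numStandardTableaux hn μ hrow hcol
  rw [div_le_iff₀ (by norm_num : (0 : ℝ) < 24)]
  exact_mod_cast key.trans_eq (mul_comm _ _)

set_option maxHeartbeats 1600000 in
/-- **Level-two pinning.** For `n ≥ 40` and a triple `S, T, U ⊆ S_n` with the triple product
property each of whose sets lies in one sign class, with `N = |S||T||U|`, `D₃ = n(n-1)(n-2)/24` and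
the six-fold statistics `T₃` (fixed points), `P₂` (ordered pairs of distinct fixed points), `I_Σ`
(invariant `2`-subsets) of the words `s⁻¹t·t'⁻¹u·u'⁻¹s'` over `(S×T)×(T×U)×(U×S)`:
`|n!·N - (2N² + 2(n-1)(T₃-N²) + 2[(C(n,2)-n)(I_Σ-T₃) + (C(n,2)-n+1)(P₂-T₃+N²-I_Σ)])|` is at most
`N·n!·√(n!)/√D₃`. [folklore] -/
theorem levelTwoPinning (n : ℕ) (hn : 40 ≤ n) (S T U : Finset (Equiv.Perm (Fin n))) (hTPP : TripleProductProperty S T U) (hS : ∀ s ∈ S, ∀ s' ∈ S, Equiv.Perm.sign s = Equiv.Perm.sign s') (hT : ∀ t ∈ T, ∀ t' ∈ T, Equiv.Perm.sign t = Equiv.Perm.sign t') (hU : ∀ u ∈ U, ∀ u' ∈ U, Equiv.Perm.sign u = Equiv.Perm.sign u') : |(n.factorial : ℝ) * (S.card * T.card * U.card : ℕ) - (2 * (((S.card * T.card * U.card) ^ 2 : ℕ) : ℝ) + 2 * ((n : ℝ) - 1) * (((∑ y ∈ ((S ×ˢ T) ×ˢ (T ×ˢ U)) ×ˢ (U ×ˢ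 S), (Finset.univ.filter fun p : Fin n => (y.1.1.1⁻¹ * y.1.1.2 * (y.1.2.1⁻¹ * y.1.2.2) * (y.2.1⁻¹ * y.2.2)) p = p).card : ℕ) : ℝ) - (((S.card * T.card * U.card) ^ 2 : ℕ) : ℝ)) + 2 * ((((n.choose 2 : ℕ) : ℝ) - n) * (((∑ y ∈ ((S ×ˢ T) ×ˢ (T ×ˢ U)) ×ˢ (U ×ˢ S), ((Finset.powersetCard 2 (Finset.univ : Finset (Fin n))).filter fun s => ∀ p ∈ s, (y.1.1.1⁻¹ * y.1.1.2 * (y.1.2.1⁻¹ * y.1.2.2) * (y.2.1⁻¹ * y.2.2)) p ∈ s).card : ℕ) : ℝ) - ((∑ y ∈ ((S ×ˢ T) ×ˢ (T ×ˢ U)) ×ˢ (U ×ˢ S), (Finset.univ.filter fun p : Fin n => (y.1.1.1⁻¹ * y.1.1.2 * (y.1.2.1⁻¹ * y.1.2.2) * (y.2.1⁻¹ * y.2.2)) p = p).card : ℕ) : ℝ)) + (((n.choose 2 : ℕ) : ℝ) - n + 1) * (((∑ y ∈ ((S ×ˢ T) ×ˢ (T ×ˢ U)) ×ˢ (U ×ˢ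 S), (Finset.univ.filter fun pq : Fin n × Fin n => pq.1 ≠ pq.2 ∧ (y.1.1.1⁻¹ * y.1.1.2 * (y.1.2.1⁻¹ * y.1.2.2) * (y.2.1⁻¹ * y.2.2)) pq.1 = pq.1 ∧ (y.1.1.1⁻¹ * y.1.1.2 * (y.1.2.1⁻¹ * y.1.2.2) * (y.2.1⁻¹ * y.2.2)) pq.2 = pq.2).card : ℕ) : ℝ) - ((∑ y ∈ ((S ×ˢ T) ×ˢ (T ×ˢ U)) ×ˢ (U ×ˢ S), (Finset.univ.filter fun p : Fin n => (y.1.1.1⁻¹ * y.1.1.2 * (y.1.2.1⁻¹ * y.1.2.2) * (y.2.1⁻¹ * y.2.2)) p = p).card : ℕ) : ℝ) + (((S.card * T.card * U.card) ^ 2 : ℕ) : ℝ) - ((∑ y ∈ ((S ×ˢ T) ×ˢ (T ×ˢ U)) ×ˢ (U ×ˢ S), ((Finset.powersetCard 2 (Finset.univ : Finset (Fin n))).filter fun s => ∀ p ∈ s, (y.1.1.1⁻¹ * y.1.1.2 * (y.1.2.1⁻¹ * y.1.2.2) * (y.2.1⁻¹ * y.2.2)) p ∈ s).card : ℕ) :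 ℝ))))| ≤ (S.card * T.card * U.card : ℕ) * ((n.factorial : ℝ) * Real.sqrt (n.factorial : ℝ)) / Real.sqrt (((n * (n - 1) * (n - 2) : ℕ) : ℝ) / 24) := by
  classical
  -- notation
  set N : ℕ := S.card * T.card * U.card with hN
  set T₃ : ℕ := ∑ y ∈ ((S ×ˢ T) ×ˢ (T ×ˢ U)) ×ˢ (U ×ˢ S),
      (Finset.univ.filter fun p : Fin n =>
        (y.1.1.1⁻¹ * y.1.1.2 * (y.1.2.1⁻¹ * y.1.2.2) * (y.2.1⁻¹ * y.2.2)) p = p).card with hT₃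
  set P₂ : ℕ := ∑ y ∈ ((S ×ˢ T) ×ˢ (T ×ˢ U)) ×ˢ (U ×ˢ S),
      (Finset.univ.filter fun pq : Fin n × Fin n => pq.1 ≠ pq.2 ∧
        (y.1.1.1⁻¹ * y.1.1.2 * (y.1.2.1⁻¹ * y.1.2.2) * (y.2.1⁻¹ * y.2.2)) pq.1 = pq.1 ∧
        (y.1.1.1⁻¹ * y.1.1.2 * (y.1.2.1⁻¹ * y.1.2.2) * (y.2.1⁻¹ * y.2.2)) pq.2 = pq.2).card with hP₂
  set I₂ : ℕ := ∑ y ∈ ((S ×ˢ T) ×ˢ (T ×ˢ U)) ×ˢ (U ×ˢ S),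
      ((Finset.powersetCard 2 (Finset.univ : Finset (Fin n))).filter fun s => ∀ p ∈ s,
        (y.1.1.1⁻¹ * y.1.1.2 * (y.1.2.1⁻¹ * y.1.2.2) * (y.2.1⁻¹ * y.2.2)) p ∈ s).card with hI₂
  set cG : ℝ := (n.factorial : ℝ) with hcG
  set D : ℝ := ((n * (n - 1) * (n - 2) : ℕ) : ℝ) / 24 with hD
  set Cn : ℝ := ((n.choose 2 : ℕ) : ℝ) with hCn
  have hD0 : 0 < D := by
    rw [hD]; apply div_pos _ (by norm_num)
    have : 0 < n * (n - 1) * (n - 2) := Nat.mul_pos (Nat.mul_pos (by omega) (by omega)) (by omega)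
    exact_mod_cast this
  -- degenerate case: an empty set
  by_cases hN0 : N = 0
  · have hsix : (((S ×ˢ T) ×ˢ (T ×ˢ U)) ×ˢ (U ×ˢ S)) = ∅ := by
      rw [← Finset.card_eq_zero, card_six, ← hN, hN0]; rfl
    have hT0 : T₃ = 0 := by rw [hT₃, hsix, Finset.sum_empty]
    have hP0 : P₂ = 0 := by rw [hP₂, hsix, Finset.sum_empty]
    have hI0 : I₂ = 0 := by rw [hI₂, hsix, Finset.sum_empty]
    rw [hT0, hP0, hI0, hN0]
    simp
  have hSne : S.Nonempty := Finset.card_ne_zero.1 fun h => hN0 (by simp [hN, h])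
  have hTne : T.Nonempty := Finset.card_ne_zero.1 fun h => hN0 (by simp [hN, h])
  have hUne : U.Nonempty := Finset.card_ne_zero.1 fun h => hN0 (by simp [hN, h])
  -- a unitary Wedderburn decomposition and its dictionary with partitions
  obtain ⟨r, d, hd, φ, hφ⟩ :=
    Literature.RepresentationTheory.FiniteGroups.exists_unitary_algEquiv_pi_matrix
      (Equiv.Perm (Fin n))
  haveI : ∀ i, NeZero (d i) := hd
  obtain ⟨part, hbij, hchar, hdeg, -, -⟩ := stub_blockDictionary n φ hφ
  -- the three transforms and the six-fold element
  set a : ∀ i : Fin r, Matrix (Fin (d i)) (Fin (d i)) ℂ := fun i => φ (indicatorElem ℂ S) i with ha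
  set t : ∀ i : Fin r, Matrix (Fin (d i)) (Fin (d i)) ℂ := fun i => φ (indicatorElem ℂ T) i with ht
  set u : ∀ i : Fin r, Matrix (Fin (d i)) (Fin (d i)) ℂ := fun i => φ (indicatorElem ℂ U) i with hu
  set A : ∀ i : Fin r, Matrix (Fin (d i)) (Fin (d i)) ℂ := fun i => (a i)ᴴ * t i with hA
  set B : ∀ i : Fin r, Matrix (Fin (d i)) (Fin (d i)) ℂ := fun i => (t i)ᴴ * u i with hB
  set C : ∀ i : Fin r, Matrix (Fin (d i)) (Fin (d i)) ℂ := fun i => (u i)ᴴ * a i with hC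
  have hconj :=
    Literature.Barriers.MatrixMultiplication.algEquiv_indicatorElemInv_eq_conjTranspose φ hφ
  have hPA : ∀ i, φ (indicatorElemInv ℂ S * indicatorElem ℂ T) i = A i := fun i => by
    rw [map_mul, Pi.mul_apply, hconj]
  have hQB : ∀ i, φ (indicatorElemInv ℂ T * indicatorElem ℂ U) i = B i := fun i => by
    rw [map_mul, Pi.mul_apply, hconj]
  have hRC : ∀ i, φ (indicatorElemInv ℂ U * indicatorElem ℂ S) i = C i := fun i => by
    rw [map_mul, Pi.mul_apply, hconj]
  have hZ : ∀ i, φ ((indicatorElemInv ℂ S * indicatorElem ℂ T) *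
      (indicatorElemInv ℂ T * indicatorElem ℂ U) * (indicatorElemInv ℂ U * indicatorElem ℂ S)) i =
        A i * B i * C i := fun i => by
    rw [map_mul, map_mul, Pi.mul_apply, Pi.mul_apply, hPA, hQB, hRC]
  -- (1) Fourier inversion at `1` + TPP count: `|G| N = ∑ dᵢ Re tr(Aᵢ Bᵢ Cᵢ)`
  have h1 : (cG * N : ℝ) = ∑ i, (d i : ℝ) * (A i * B i * C i).trace.re := by
    have h := Literature.RepresentationTheory.FiniteGroups.card_mul_coeff_one_eq_sum_trace φ
      ((indicatorElemInv ℂ S * indicatorElem ℂ T) * (indicatorElemInv ℂ T * indicatorElem ℂ U) *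
        (indicatorElemInv ℂ U * indicatorElem ℂ S))
    rw [hTPP.coeff_one_six] at h
    simp only [hZ] at h
    have h' := congrArg Complex.re h
    rw [Complex.re_sum] at h'
    rw [Fintype.card_perm, Fintype.card_fin] at h'
    simpa [hcG, hN] using h'
  -- (2) Parseval: `∑ dᵢ ‖Aᵢ‖² = |G||S||T|` and cyclically
  have h2A : ∑ i, (d i : ℝ) * ((A i)ᴴ * A i).trace.re = cG * (S.card * T.card) := by
    have h := Literature.Barriers.MatrixMultiplication.parseval_of_adjoint φ
      (indicatorElemInv ℂ S * indicatorElem ℂ T) (indicatorElemInv ℂ T * indicatorElem ℂ S)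
      fun i => by
      rw [hPA, map_mul, Pi.mul_apply, hconj, hA]
      simp only [Matrix.conjTranspose_mul, Matrix.conjTranspose_conjTranspose]
      rfl
    rw [hTPP.coeff_one_four hUne] at h
    simp only [hPA] at h
    rw [Fintype.card_perm, Fintype.card_fin] at h
    rw [hcG]
    exact_mod_cast h
  have h2B : ∑ i, (d i : ℝ) * ((B i)ᴴ * B i).trace.re = cG * (T.card * U.card) := by
    have h := Literature.Barriers.MatrixMultiplication.parseval_of_adjoint φ
      (indicatorElemInv ℂ T * indicatorElem ℂ U) (indicatorElemInv ℂ U * indicatorElem ℂ T)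
      fun i => by
      rw [hQB, map_mul, Pi.mul_apply, hconj, hB]
      simp only [Matrix.conjTranspose_mul, Matrix.conjTranspose_conjTranspose]
      rfl
    rw [hTPP.rotate.coeff_one_four hSne] at h
    simp only [hQB] at h
    rw [Fintype.card_perm, Fintype.card_fin] at h
    rw [hcG]
    exact_mod_cast h
  have h2C : ∑ i, (d i : ℝ) * ((C i)ᴴ * C i).trace.re = cG * (U.card * S.card) := by
    have h := Literature.Barriers.MatrixMultiplication.parseval_of_adjoint φ
      (indicatorElemInv ℂ U * indicatorElem ℂ S) (indicatorElemInv ℂ S * indicatorElem ℂ U)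
      fun i => by
      rw [hRC, map_mul, Pi.mul_apply, hconj, hC]
      simp only [Matrix.conjTranspose_mul, Matrix.conjTranspose_conjTranspose]
      rfl
    rw [hTPP.rotate.rotate.coeff_one_four hTne] at h
    simp only [hRC] at h
    rw [Fintype.card_perm, Fintype.card_fin] at h
    rw [hcG]
    exact_mod_cast h
  -- (3) the LOW blocks: the eight partitions of level `≤ 2`
  have hn1 : 1 ≤ n := by omega
  have hn2 : 2 ≤ n := by omega
  have hn3 : 3 ≤ n := by omega
  have hn4 : 4 ≤ n := by omega
  have hex : ∀ Λ : List ℕ, (∃ μ : Nat.Partition n, μ.sortedParts = Λ) →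
      ∃ i, (part i).sortedParts = Λ :=
    fun Λ ⟨μ, hμ⟩ => (hbij.2 μ).imp fun i hi => by rw [hi, hμ]
  obtain ⟨i₁, hs₁⟩ := hex _ (exists_partition_single hn1)
  obtain ⟨i₂, hs₂⟩ := hex _ (exists_partition_hook hn2)
  obtain ⟨i₃, hs₃⟩ := hex _ (exists_partition_twoRowTwo hn4)
  obtain ⟨i₄, hs₄⟩ := hex _ (exists_partition_twoRowOneOne hn4)
  obtain ⟨i₅, hs₅⟩ := hex _ (exists_partition_column n)
  obtain ⟨i₆, hs₆⟩ := hex _ (exists_partition_twoColumn hn2)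
  obtain ⟨i₇, hs₇⟩ := hex _ (exists_partition_twoTwoColumn hn4)
  obtain ⟨i₈, hs₈⟩ := hex _ (exists_partition_threeColumn hn3)
  -- the eight shapes are distinct, so the eight indices are
  set lows : List (List ℕ) := [[n], [n - 1, 1], [n - 2, 2], [n - 2, 1, 1], List.replicate n 1,
      2 :: List.replicate (n - 2) 1, 2 :: 2 :: List.replicate (n - 4) 1,
      3 :: List.replicate (n - 3) 1] with hlows
  set L : List (Fin r) := [i₁, i₂, i₃, i₄, i₅, i₆, i₇, i₈] with hL
  have hLmap : L.map (fun i => (part i).sortedParts) = lows := by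
    simp only [hL, hlows, List.map_cons, List.map_nil, hs₁, hs₂, hs₃, hs₄, hs₅, hs₆, hs₇, hs₈]
  have hnodup : L.Nodup := by
    refine List.Nodup.of_map (fun i => (part i).sortedParts) ?_
    rw [hLmap]
    exact level_two_shapes_nodup (by omega)
  -- the predicate "low block"
  let low : Fin r → Prop := fun i => (part i).sortedParts ∈ lows
  have hlowset : Finset.univ.filter low = L.toFinset := by
    ext i
    simp only [Finset.mem_filter, Finset.mem_univ, true_and, List.mem_toFinset, low, ← hLmap,
      List.mem_map]
    exact ⟨fun ⟨j, hj, hji⟩ => hbij.1 (eq_of_sortedParts_eq hji) ▸ hj, fun hi => ⟨i, hi, rfl⟩⟩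
  -- their exact contributions
  have hchar' : ∀ i, (blockRep φ i).character = spechtCharacter ℂ (part i) := hchar
  have hdn : ∀ i, d i = n - 1 → ((d i : ℕ) : ℝ) = (n : ℝ) - 1 := fun i h => by
    rw [h, Nat.cast_sub hn1, Nat.cast_one]
  have hd1 : ∀ i, d i = 1 → ((d i : ℕ) : ℝ) = 1 := fun i h => by rw [h, Nat.cast_one]
  have eN2 : (((N ^ 2 : ℕ) : ℂ)).re = (N : ℝ) ^ 2 := by
    rw [Complex.natCast_re]; push_cast; ring
  have eT3 : (((T₃ : ℕ) : ℂ) - ((N ^ 2 : ℕ) : ℂ)).re = (T₃ : ℝ) - (N : ℝ) ^ 2 := by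
    rw [Complex.sub_re, Complex.natCast_re, eN2]
  have eI : (((I₂ : ℕ) : ℂ) - ((T₃ : ℕ) : ℂ)).re = (I₂ : ℝ) - T₃ := by
    rw [Complex.sub_re, Complex.natCast_re, Complex.natCast_re]
  have eP : (((P₂ : ℕ) : ℂ) - ((T₃ : ℕ) : ℂ) + ((N ^ 2 : ℕ) : ℂ) - ((I₂ : ℕ) : ℂ)).re =
      (P₂ : ℝ) - T₃ + (N : ℝ) ^ 2 - I₂ := by
    rw [Complex.sub_re, Complex.add_re, Complex.sub_re, Complex.natCast_re, Complex.natCast_re, eN2,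
      Complex.natCast_re]
  have e₁ : (d i₁ : ℝ) * (A i₁ * B i₁ * C i₁).trace.re = (N : ℝ) ^ 2 := by
    rw [← hZ, trace_six_of_single φ part hchar' S T U hs₁, hd1 i₁ (degree_of_single φ part hchar' hs₁),
      ← hN, eN2, one_mul]
  have e₂ : (d i₂ : ℝ) * (A i₂ * B i₂ * C i₂).trace.re = ((n : ℝ) - 1) * ((T₃ : ℝ) - (N : ℝ) ^ 2) := by
    rw [← hZ, trace_six_of_hook φ part hchar' S T U hn2 hs₂,
      hdn i₂ (degree_of_hook φ part hchar' hn2 hs₂), ← hN, ← hT₃, eT3]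
  have e₃ : (d i₃ : ℝ) * (A i₃ * B i₃ * C i₃).trace.re = (Cn - n) * ((I₂ : ℝ) - T₃) := by
    rw [← hZ, trace_six_of_twoRowTwo φ part hchar' S T U hn4 hs₃,
      degree_of_twoRowTwo φ part hchar' hn4 hs₃, ← hI₂, ← hT₃, eI]
  have e₄ : (d i₄ : ℝ) * (A i₄ * B i₄ * C i₄).trace.re =
      (Cn - n + 1) * ((P₂ : ℝ) - T₃ + (N : ℝ) ^ 2 - I₂) := by
    rw [← hZ, trace_six_of_twoRowOneOne φ part hchar' S T U hn4 hs₄,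
      degree_of_twoRowOneOne φ part hchar' hn4 hs₄, ← hN, ← hP₂, ← hT₃, ← hI₂, eP]
  have e₅ : (d i₅ : ℝ) * (A i₅ * B i₅ * C i₅).trace.re = (N : ℝ) ^ 2 := by
    rw [← hZ, trace_six_of_column φ part hchar' S T U hS hT hU hn1 hs₅,
      hd1 i₅ (degree_of_column φ part hchar' hn1 hs₅), ← hN, eN2, one_mul]
  have e₆ : (d i₆ : ℝ) * (A i₆ * B i₆ * C i₆).trace.re = ((n : ℝ) - 1) * ((T₃ : ℝ) - (N : ℝ) ^ 2) := by
    rw [← hZ, trace_six_of_twoColumn φ part hchar' S T U hS hT hU hn3 hs₆,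
      hdn i₆ (degree_of_twoColumn φ part hchar' hn3 hs₆), ← hN, ← hT₃, eT3]
  have e₇ : (d i₇ : ℝ) * (A i₇ * B i₇ * C i₇).trace.re = (Cn - n) * ((I₂ : ℝ) - T₃) := by
    rw [← hZ, trace_six_of_twoTwoColumn φ part hchar' S T U hS hT hU hn4 hs₇,
      degree_of_twoTwoColumn φ part hchar' hn4 hs₇, ← hI₂, ← hT₃, eI]
  have e₈ : (d i₈ : ℝ) * (A i₈ * B i₈ * C i₈).trace.re =
      (Cn - n + 1) * ((P₂ : ℝ) - T₃ + (N : ℝ) ^ 2 - I₂) := by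
    rw [← hZ, trace_six_of_threeColumn φ part hchar' S T U hS hT hU hn4 hs₈,
      degree_of_threeColumn φ part hchar' hn4 hs₈, ← hN, ← hP₂, ← hT₃, ← hI₂, eP]
  have hlow : ∑ i ∈ Finset.univ.filter low, (d i : ℝ) * (A i * B i * C i).trace.re =
      2 * (N : ℝ) ^ 2 + 2 * ((n : ℝ) - 1) * ((T₃ : ℝ) - (N : ℝ) ^ 2) +
        2 * ((Cn - n) * ((I₂ : ℝ) - T₃) + (Cn - n + 1) * ((P₂ : ℝ) - T₃ + (N : ℝ) ^ 2 - I₂)) := by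
    rw [hlowset, List.sum_toFinset _ hnodup]
    simp only [hL, List.map_cons, List.map_nil, List.sum_cons, List.sum_nil]
    rw [e₁, e₂, e₃, e₄, e₅, e₆, e₇, e₈]
    ring
  -- (4) the HIGH blocks have dimension `≥ D`
  have hhigh : ∀ i, ¬ low i → D ≤ (d i : ℝ) := by
    intro i hi
    rw [hdeg i, hD]
    exact large_dim_of_not_low₂ hn (part i) hi
  -- (5) bound on each high block, as in BCGPU with `n(G)` replaced by `D`
  set K : ℝ := Real.sqrt (cG * (S.card * T.card) / D) with hK
  have h5 : ∀ i, ¬ low i → (d i : ℝ) * ‖(A i * B i * C i).trace‖ ≤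
      K * (Real.sqrt (d i * ((B i)ᴴ * B i).trace.re) *
        Real.sqrt (d i * ((C i)ᴴ * C i).trace.re)) := by
    intro i hi
    have hDle : D ≤ d i := hhigh i hi
    have hdi : (0 : ℝ) < d i := hD0.trans_le hDle
    -- `‖Aᵢ‖² ≤ |G||S||T| / D`
    have hAi : ((A i)ᴴ * A i).trace.re ≤ cG * (S.card * T.card) / D := by
      have hle : (d i : ℝ) * ((A i)ᴴ * A i).trace.re ≤ cG * (S.card * T.card) := by
        rw [← h2A]
        exact Finset.single_le_sum (f := fun j => (d j : ℝ) * ((A j)ᴴ * A j).trace.re)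
          (fun j _ => mul_nonneg (Nat.cast_nonneg _)
            (Literature.Barriers.MatrixMultiplication.re_trace_conjTranspose_mul_self_nonneg _))
          (Finset.mem_univ i)
      calc ((A i)ᴴ * A i).trace.re ≤ cG * (S.card * T.card) / d i := by
            rw [le_div_iff₀ hdi, mul_comm]; exact hle
        _ ≤ cG * (S.card * T.card) / D :=
            div_le_div_of_nonneg_left (by positivity) hD0 hDle
    calc (d i : ℝ) * ‖(A i * B i * C i).trace‖
        ≤ d i * (Real.sqrt (((A i)ᴴ * A i).trace.re) *
            (Real.sqrt (((B i)ᴴ * B i).trace.re) * Real.sqrt (((C i)ᴴ * C i).trace.re))) :=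
          mul_le_mul_of_nonneg_left
            (Literature.Barriers.MatrixMultiplication.norm_trace_mul_mul_le _ _ _) hdi.le
      _ ≤ d i * (K * (Real.sqrt (((B i)ᴴ * B i).trace.re) *
            Real.sqrt (((C i)ᴴ * C i).trace.re))) := by
          gcongr
          exact Real.sqrt_le_sqrt hAi
      _ = K * (Real.sqrt (d i * ((B i)ᴴ * B i).trace.re) *
            Real.sqrt (d i * ((C i)ᴴ * C i).trace.re)) := by
          rw [Real.sqrt_mul hdi.le, Real.sqrt_mul hdi.le]
          have := Real.mul_self_sqrt hdi.le
          linear_combination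
            (-(K * Real.sqrt (((B i)ᴴ * B i).trace.re) * Real.sqrt (((C i)ᴴ * C i).trace.re))) *
              this
  -- summing (5) over the high blocks, with Cauchy–Schwarz
  have hnn : ∀ (i : Fin r) (X : Matrix (Fin (d i)) (Fin (d i)) ℂ),
      0 ≤ (d i : ℝ) * (Xᴴ * X).trace.re := fun i X => mul_nonneg (Nat.cast_nonneg _)
      (Literature.Barriers.MatrixMultiplication.re_trace_conjTranspose_mul_self_nonneg _)
  have h5sum : ∑ i ∈ Finset.univ.filter (fun i => ¬ low i),
      (d i : ℝ) * ‖(A i * B i * C i).trace‖ ≤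
        K * (Real.sqrt (cG * (T.card * U.card)) * Real.sqrt (cG * (U.card * S.card))) := by
    calc ∑ i ∈ Finset.univ.filter (fun i => ¬ low i), (d i : ℝ) * ‖(A i * B i * C i).trace‖
        ≤ ∑ i ∈ Finset.univ.filter (fun i => ¬ low i),
            K * (Real.sqrt (d i * ((B i)ᴴ * B i).trace.re) *
              Real.sqrt (d i * ((C i)ᴴ * C i).trace.re)) :=
          Finset.sum_le_sum fun i hi => h5 i (Finset.mem_filter.1 hi).2
      _ ≤ ∑ i, K * (Real.sqrt (d i * ((B i)ᴴ * B i).trace.re) *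
            Real.sqrt (d i * ((C i)ᴴ * C i).trace.re)) :=
          Finset.sum_le_univ_sum_of_nonneg fun i => by positivity
      _ = K * ∑ i, Real.sqrt (d i * ((B i)ᴴ * B i).trace.re) *
            Real.sqrt (d i * ((C i)ᴴ * C i).trace.re) := by
          rw [Finset.mul_sum]
      _ ≤ K * (Real.sqrt (∑ i, (d i : ℝ) * ((B i)ᴴ * B i).trace.re) *
            Real.sqrt (∑ i, (d i : ℝ) * ((C i)ᴴ * C i).trace.re)) := by
          gcongr
          exact Real.sum_sqrt_mul_sqrt_le _ (fun i => hnn i (B i)) (fun i => hnn i (C i))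
      _ = K * (Real.sqrt (cG * (T.card * U.card)) * Real.sqrt (cG * (U.card * S.card))) := by
          rw [h2B, h2C]
  -- the error term equals `N |G| √|G| / √D`
  have hErr : K * (Real.sqrt (cG * (T.card * U.card)) * Real.sqrt (cG * (U.card * S.card))) =
      N * (cG * Real.sqrt cG) / Real.sqrt D := by
    have hG0 : 0 ≤ cG := Nat.cast_nonneg _
    have hS' : (0 : ℝ) ≤ S.card := Nat.cast_nonneg _
    have hT' : (0 : ℝ) ≤ T.card := Nat.cast_nonneg _
    have hU' : (0 : ℝ) ≤ U.card := Nat.cast_nonneg _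
    rw [hK, Real.sqrt_div (by positivity), Real.sqrt_mul hG0, Real.sqrt_mul hG0, Real.sqrt_mul hG0,
      Real.sqrt_mul hS', Real.sqrt_mul hT', Real.sqrt_mul hU', hN]
    push_cast
    have eG := Real.mul_self_sqrt hG0
    have eS := Real.mul_self_sqrt hS'
    have eT := Real.mul_self_sqrt hT'
    have eU := Real.mul_self_sqrt hU'
    calc Real.sqrt cG * (Real.sqrt S.card * Real.sqrt T.card) / Real.sqrt D *
          (Real.sqrt cG * (Real.sqrt T.card * Real.sqrt U.card) *
            (Real.sqrt cG * (Real.sqrt U.card * Real.sqrt S.card)))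
        = (Real.sqrt S.card * Real.sqrt S.card) * (Real.sqrt T.card * Real.sqrt T.card) *
            (Real.sqrt U.card * Real.sqrt U.card) *
            ((Real.sqrt cG * Real.sqrt cG) * Real.sqrt cG) / Real.sqrt D := by ring
      _ = S.card * T.card * U.card * (cG * Real.sqrt cG) / Real.sqrt D := by rw [eG, eS, eT, eU]
  -- (6) assemble: `n!·N - (low blocks) = (high blocks)` and `|high| ≤ Σ_high dᵢ ‖tr‖ ≤ N n!√n!/√D`
  have hsplit := Finset.sum_filter_add_sum_filter_not Finset.univ low
    (fun i => (d i : ℝ) * (A i * B i * C i).trace.re)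
  have habs : |∑ i ∈ Finset.univ.filter (fun i => ¬ low i),
      (d i : ℝ) * (A i * B i * C i).trace.re| ≤ N * (cG * Real.sqrt cG) / Real.sqrt D := by
    rw [← hErr]
    refine (Finset.abs_sum_le_sum_abs _ _).trans ((Finset.sum_le_sum fun i _ => ?_).trans h5sum)
    rw [abs_mul, Nat.abs_cast]
    exact mul_le_mul_of_nonneg_left (Complex.abs_re_le_norm _) (Nat.cast_nonneg _)
  have e2 : (((N ^ 2 : ℕ) : ℝ)) = (N : ℝ) ^ 2 := by push_cast; ring
  rw [e2, h1, ← hsplit, hlow, abs_le]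
  obtain ⟨hlo, hhi⟩ := abs_le.1 habs
  constructor <;> linarith

end Summit.MatrixMultiplication.MatrixMultiplication.Theorems.PolynomialSlack
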